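import Summits.BirchSwinnertonDyer.BirchSwinnertonDyer.Theses.SignedLowerHalves
import Summits.BirchSwinnertonDyer.BirchSwinnertonDyer.Theorems.SignedLowerHalvesKobayashiLowerHalfSemistableMuSplit
import HarnessLib

/-!
# Line `birth_musplit` — crux `KobayashiLowerHalfSemistable` (route SignedLowerHalves, rank 2,
# item stmt-BirchSwinnertonDyer-19000): the skeleton `birth` RE-CUT ALONG THE μ-SEAM

Pen word D34-1 (c) (bsd-ssimc-plan g34, 2026-08-28T08:06:44Z): the μ-seam cut proposed by seat
bsd-line-slh-p2 gen 3 (item evidence #54 `birth_musplit.lean`, sha16 84e721da3d57da24) is ADOPTED as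
the preferred cut of line `birth`; this file is that cut, rebuilt by gen 5 of the same seat against
the tree file `Theorems/SignedLowerHalvesKobayashiLowerHalfSemistableMuSplit.lean` (p612910 +
p613395; the #54 blob itself is not mounted in a prover jail, so the bytes differ, the mathematics
does not). `Lines/birth.lean` (7996fe65, stubs `stub_five_le` / `stub_three`) stays as a line file.

THE CUT. On class X6 at an odd prime (`good`, `ρ̄` irreducible automatic) and granted the two
PUBLISHED period comparisons `h5 ∧ h3` (`ord_p(Ω⁺_f/Ω_E) = 0`), the typed Eisenstein half
`KobayashiLowerDivisibility W p ε` is EXACTLY (tree theorem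
`MuSplit.X6.kobayashiLowerDivisibility_iff_dvd_C_pow_mul_and_mu_le`) the conjunction of
* a RATIONAL divisibility `L^ε ∣ p^t · g` in `Λ` (`char X^ε = (g)`), i.e. the Eisenstein
  divisibility in `Λ ⊗ ℚ_p` — the raw output of the Beilinson–Flach / GU(3,1) engine of
  Burungale–Skinner–Tian–Wan (arXiv:2409.01350 Thm. 1.3; the part of the cell's audit that passed
  cleanly, REPORT-bstw-11), sign-blind (both signs are rationally equivalent to Kato's lower
  divisibility, Kobayashi 2003 Thm. 1.3), and
* a `μ`-INEQUALITY `μ(L^ε) ≤ μ(g)` for ONE sign — the separate `μ`-step of that proof (the cell's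
  S5, re-derived adversarially in bstw MEMO-22) and the content of Pollack 2003 Conj. 6.3 weakened
  to one sign (`μ(L_p^+) = 0 ∨ μ(L_p^−) = 0` suffices: `MuSplit` §6).
So `birth`'s two regime stubs (p ≥ 5 / p = 3) become 2 × 2 stubs + ONE held cite-only stub:

* `stub_periodFacts` (HELD, cite-only): `realPeriodRat_eq_unit_mul_plusPeriod ∧ …_three`
  (Greenberg–Vatsal 2000 Rem. 3.4 + Manin constant; BOTH are tree THEOREMS granted the single
  printed fact `mazur_not_dvd_maninConstant_of_odd` = Mazur 1978 Cor. 4.1, via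
  `SkinnerUrban2014/PAdicUnitPeriodRatioProofs.periodUnit_facts_of_mazur`) — size: cite;
* `stub_five_le_rational` (p ≥ 5, EVERY sign, `Λ ⊗ ℚ_p`) and `stub_three_rational` (p = 3) —
  size XL each: the BF/GU(3,1) engine (PRE);
* `stub_five_le_mu` (p ≥ 5, ∃ sign) and `stub_three_mu` (p = 3) — size L–XL: `μ(L^ε) ≤ μ(char X^ε)`
  for one sign (⇐ `μ(L_p^ε) = 0` for one sign, Pollack Conj. 6.3; or ⇐ the BSTW `μ`-step).

COMPOSITION (kernel-checked, no sorry of its own): `merge` (two generators of the same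
characteristic ideal have the same `μ`) + `MuSplit.X6.exists_kobayashiLowerDivisibility_of_dvd_C_pow_mul_of_mu_le`
per regime (`five_le`, `three`), then the odd primes are `{3} ∪ {≥ 5}` (`interval_cases`) and
`KobayashiLowerHalfSemistable_of` concludes the crux BY NAME with NO hypotheses. Kernel state of the
crux is UNCHANGED by the re-cut (every stub is still implied by the binders behind the closer of
record p563654 `…Theorems.KobayashiLowerHalfSemistable_of_tiersS_C3` + `MuSplit` necessity
`dvd_and_mu_le_of_kobayashiLowerDivisibility`); BSD / the crux are NOT proved by this file.
-/

set_option autoImplicit false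
set_option linter.dupNamespace false

noncomputable section

open scoped Classical MatrixGroups ModularForm

open CongruenceSubgroup WeierstrassCurve Literature.NumberTheory.EllipticCurves
  Literature.NumberTheory.EllipticCurves.ModularForms
  Literature.NumberTheory.EllipticCurves.Rank1Residual
  Literature.NumberTheory.EllipticCurves.Rank1Residual.Typed
  Literature.NumberTheory.EllipticCurves.Kobayashi2003 ZpExtension
  Summit.BirchSwinnertonDyer.Rank1Residual
  Summit.BirchSwinnertonDyer.Rank1Residual.Supersingular
  Summit.BirchSwinnertonDyer.Rank1Residual.X1

namespace Summit.BirchSwinnertonDyer.BirchSwinnertonDyer.Cruxes.KobayashiLowerHalfSemistable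

namespace BirthMuSplit

/-! ### The five registered stubs (the ONLY sorried declarations) -/

/-- stub (HELD, cite-only): the two published period comparisons `ord_p(Ω⁺_f/Ω_E) = 0` at an odd good
prime with `E[p]` irreducible — Greenberg–Vatsal 2000 §3 Rem. 3.4 with the Manin constant
(Mazur 1978 Cor. 4.1); tree: both conjuncts follow from `mazur_not_dvd_maninConstant_of_odd` by
`periodUnit_facts_of_mazur`. [cite: GreenbergVatsal2000, §3, Remark 3.4] [cite: Mazur1978, Cor. 4.1] -/
theorem stub_periodFacts :
    realPeriodRat_eq_unit_mul_plusPeriod ∧ realPeriodRat_eq_unit_mul_plusPeriod_three := by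
  sorry

/-- stub (p ≥ 5, RATIONAL part, every sign): on X6 at a prime `p ≥ 5`, for EVERY sign `ε` and every
admissible datum, some generator `g` of `char X^ε(E/ℚ_∞)` satisfies `L^ε ∣ p^t · g` for some `t`
(the Eisenstein divisibility in `Λ ⊗ ℚ_p`; BSTW arXiv:2409.01350 Thm. 1.3 engine, PRE). -/
theorem stub_five_le_rational : ∀ (W : WeierstrassCurve ℚ) [W.IsElliptic] [W.IsGloballyMinimal]
    (p : ℕ) [Fact p.Prime], p ≠ 2 → ClassX6 W p → 5 ≤ p →
    ∀ (ε : ℤˣ) (κ : ZpExtension ℚ p) (γ : Field.absoluteGaloisGroup ℚ),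
      κ.IsCyclotomic → κ.IsTopGenerator γ → IsCyclotomicVariable p γ →
    ∀ [NeZero (W.conductorNorm ℤ)] (f : CuspForm (Gamma0 (W.conductorNorm ℤ)) 2),
      IsNewformOf W f → ∀ (ϖ : ℚ), (ϖ : ℝ) * W.realPeriodRat = plusPeriod f →
    ∀ (Lplus Lminus : IwasawaAlgebra p), IsPollackPair f p Lplus Lminus →
    ∀ (D : SignedSelmerDualData W κ γ ε),
      ∃ (g : IwasawaAlgebra p) (t : ℕ), D.charIdeal = Ideal.span {g} ∧
        kobayashiL ε Lplus Lminus ∣ PowerSeries.C (p : ℤ_[p]) ^ t * g := by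
  sorry

/-- stub (p ≥ 5, μ-part, ONE sign): on X6 at a prime `p ≥ 5` there is a sign `ε` such that for every
admissible datum some generator `g` of `char X^ε(E/ℚ_∞)` has `μ(L^ε) ≤ μ(g)` (⇐ `μ(L_p^ε) = 0` for one
sign, Pollack 2003 Conj. 6.3; or the `μ`-step S5 of BSTW). -/
theorem stub_five_le_mu : ∀ (W : WeierstrassCurve ℚ) [W.IsElliptic] [W.IsGloballyMinimal]
    (p : ℕ) [Fact p.Prime], p ≠ 2 → ClassX6 W p → 5 ≤ p →
    ∃ ε : ℤˣ, ∀ (κ : ZpExtension ℚ p) (γ : Field.absoluteGaloisGroup ℚ),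
      κ.IsCyclotomic → κ.IsTopGenerator γ → IsCyclotomicVariable p γ →
    ∀ [NeZero (W.conductorNorm ℤ)] (f : CuspForm (Gamma0 (W.conductorNorm ℤ)) 2),
      IsNewformOf W f → ∀ (ϖ : ℚ), (ϖ : ℝ) * W.realPeriodRat = plusPeriod f →
    ∀ (Lplus Lminus : IwasawaAlgebra p), IsPollackPair f p Lplus Lminus →
    ∀ (D : SignedSelmerDualData W κ γ ε),
      ∃ g : IwasawaAlgebra p, D.charIdeal = Ideal.span {g} ∧
        MuLambda.mu (kobayashiL ε Lplus Lminus) ≤ MuLambda.mu g := by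
  sorry

/-- stub (p = 3, RATIONAL part, every sign): on X6 at `3` (`a_3 = 0`), for EVERY sign and every
admissible datum, `L^ε ∣ 3^t · g` for some generator `g` of `char X^ε` and some `t` (BSTW engine at 3
+ the cell's CHECK(3-ii)/(3-vi); PRE). -/
theorem stub_three_rational : ∀ (W : WeierstrassCurve ℚ) [W.IsElliptic] [W.IsGloballyMinimal],
    ClassX6 W 3 →
    ∀ (ε : ℤˣ) (κ : ZpExtension ℚ 3) (γ : Field.absoluteGaloisGroup ℚ),
      κ.IsCyclotomic → κ.IsTopGenerator γ → IsCyclotomicVariable 3 γ →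
    ∀ [NeZero (W.conductorNorm ℤ)] (f : CuspForm (Gamma0 (W.conductorNorm ℤ)) 2),
      IsNewformOf W f → ∀ (ϖ : ℚ), (ϖ : ℝ) * W.realPeriodRat = plusPeriod f →
    ∀ (Lplus Lminus : IwasawaAlgebra 3), IsPollackPair f 3 Lplus Lminus →
    ∀ (D : SignedSelmerDualData W κ γ ε),
      ∃ (g : IwasawaAlgebra 3) (t : ℕ), D.charIdeal = Ideal.span {g} ∧
        kobayashiL ε Lplus Lminus ∣ PowerSeries.C (3 : ℤ_[3]) ^ t * g := by
  sorry

/-- stub (p = 3, μ-part, ONE sign): on X6 at `3` there is a sign `ε` with `μ(L^ε) ≤ μ(g)` for some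
generator `g` of `char X^ε`, for every admissible datum. -/
theorem stub_three_mu : ∀ (W : WeierstrassCurve ℚ) [W.IsElliptic] [W.IsGloballyMinimal],
    ClassX6 W 3 →
    ∃ ε : ℤˣ, ∀ (κ : ZpExtension ℚ 3) (γ : Field.absoluteGaloisGroup ℚ),
      κ.IsCyclotomic → κ.IsTopGenerator γ → IsCyclotomicVariable 3 γ →
    ∀ [NeZero (W.conductorNorm ℤ)] (f : CuspForm (Gamma0 (W.conductorNorm ℤ)) 2),
      IsNewformOf W f → ∀ (ϖ : ℚ), (ϖ : ℝ) * W.realPeriodRat = plusPeriod f →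
    ∀ (Lplus Lminus : IwasawaAlgebra 3), IsPollackPair f 3 Lplus Lminus →
    ∀ (D : SignedSelmerDualData W κ γ ε),
      ∃ g : IwasawaAlgebra 3, D.charIdeal = Ideal.span {g} ∧
        MuLambda.mu (kobayashiL ε Lplus Lminus) ≤ MuLambda.mu g := by
  sorry

/-! ### Glue (proved) -/

/-- **merge**: two generators of the same (characteristic) ideal of the domain `Λ` are associated,
hence have the same `μ`; so a `μ`-inequality against one generator transfers to any other.
[cite: GreenbergVatsal2000, p. 4 (after Thm. (1.2))] -/
theorem merge {p : ℕ} [Fact p.Prime] {I : Ideal (IwasawaAlgebra p)} {L g g' : IwasawaAlgebra p}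
    (hg : I = Ideal.span {g}) (hg' : I = Ideal.span {g'}) (hg0 : g ≠ 0)
    (hμ : MuLambda.mu L ≤ MuLambda.mu g') : MuLambda.mu L ≤ MuLambda.mu g := by
  have hspan : Ideal.span ({g} : Set (IwasawaAlgebra p)) = Ideal.span {g'} := hg.symm.trans hg'
  obtain ⟨u, hu⟩ := Ideal.span_singleton_eq_span_singleton.mp hspan
  -- `hu : g * ↑u = g'`
  have hg'0 : g' ≠ 0 := by
    rw [← hu]; exact mul_ne_zero hg0 u.ne_zero
  have hfac : g' = g * (u : IwasawaAlgebra p) := hu.symm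
  have hμeq : MuLambda.mu g' = MuLambda.mu g :=
    ((MuLambda.span_eq_span_iff_mu_lam hg0 hg'0 hfac).mp hspan.symm).1
  exact hμeq ▸ hμ

/-- Regime `p ≥ 5`: `∃ ε, KobayashiLowerDivisibility W p ε` on X6 from `stub_periodFacts`,
`stub_five_le_rational` (at the sign of) `stub_five_le_mu`, via the tree's μ-split. -/
theorem five_le (W : WeierstrassCurve ℚ) [W.IsElliptic] [W.IsGloballyMinimal] (p : ℕ) [Fact p.Prime]
    (hp : p ≠ 2) (hX : ClassX6 W p) (h5p : 5 ≤ p) :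
    ∃ ε : ℤˣ, KobayashiLowerDivisibility W p ε := by
  obtain ⟨h5, h3⟩ := stub_periodFacts
  obtain ⟨ε, hμ⟩ := stub_five_le_mu W p hp hX h5p
  refine Theorems.MuSplit.X6.exists_kobayashiLowerDivisibility_of_dvd_C_pow_mul_of_mu_le
    W p h5 h3 hp hX ε ?_
  intro κ γ hκ hγ hv _ f hf ϖ hϖ Lplus Lminus hPP D
  obtain ⟨g, t, hchar, hdvd⟩ :=
    stub_five_le_rational W p hp hX h5p ε κ γ hκ hγ hv f hf ϖ hϖ Lplus Lminus hPP D
  obtain ⟨g', hchar', hμ'⟩ := hμ κ γ hκ hγ hv f hf ϖ hϖ Lplus Lminus hPP D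
  exact ⟨g, t, hchar, hdvd,
    merge hchar hchar' (Theorems.SignedLengthDoors.ne_zero_of_charIdeal_eq_span D hchar) hμ'⟩

/-- Regime `p = 3`: the same from `stub_periodFacts`, `stub_three_rational`, `stub_three_mu`. -/
theorem three (W : WeierstrassCurve ℚ) [W.IsElliptic] [W.IsGloballyMinimal] (hX : ClassX6 W 3) :
    ∃ ε : ℤˣ, KobayashiLowerDivisibility W 3 ε := by
  obtain ⟨h5, h3⟩ := stub_periodFacts
  obtain ⟨ε, hμ⟩ := stub_three_mu W hX
  refine Theorems.MuSplit.X6.exists_kobayashiLowerDivisibility_of_dvd_C_pow_mul_of_mu_le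
    W 3 h5 h3 (by decide) hX ε ?_
  intro κ γ hκ hγ hv _ f hf ϖ hϖ Lplus Lminus hPP D
  obtain ⟨g, t, hchar, hdvd⟩ :=
    stub_three_rational W hX ε κ γ hκ hγ hv f hf ϖ hϖ Lplus Lminus hPP D
  obtain ⟨g', hchar', hμ'⟩ := hμ κ γ hκ hγ hv f hf ϖ hϖ Lplus Lminus hPP D
  exact ⟨g, t, hchar, by exact_mod_cast hdvd,
    merge hchar hchar' (Theorems.SignedLengthDoors.ne_zero_of_charIdeal_eq_span D hchar) hμ'⟩

/-- composition = THE SKELETON: the crux BY NAME from exactly the five registered stubs (odd primes =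
`{3} ∪ {p ≥ 5}`); kernel-checked, no sorry of its own. -/
theorem KobayashiLowerHalfSemistable_of :
    Summit.BirchSwinnertonDyer.BirchSwinnertonDyer.Theses.SignedLowerHalves.KobayashiLowerHalfSemistable := by
  intro W _ _ p hpF hp hX
  by_cases h : 5 ≤ p
  · exact five_le W p hp hX h
  · have h2 := hpF.out.two_le
    have hlt : p < 5 := Nat.lt_of_not_le h
    interval_cases p
    · exact absurd rfl hp
    · exact three W hX
    · exact absurd hpF.out (by decide)

end BirthMuSplit

end Summit.BirchSwinnertonDyer.BirchSwinnertonDyer.Cruxes.KobayashiLowerHalfSemistable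

end
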